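import Mathlib
import Literature.NumberTheory.Irrationality.Fischler2002.VasilyevSorokinProofs
import Literature.NumberTheory.Irrationality.Zlobin2005.SorokinIntegralCoefficients
import HarnessLib

/-!
# Zlobin 2005, eq. (3): Vasilyev's integral `V_{2l+1,n}` in nested-product form — PROVED

Topic `Literature/NumberTheory/Irrationality/Zlobin2005`; proofs-only companion of `SorokinIntegralCoefficients.lean`, whose NAMED
FACT `vasilyevIntegral_eq_nestedProduct` is DISCHARGED here as `vasilyevIntegral_eq_nestedProduct_holds`. Cell `pub-zeta5`,
seat ct-1 g30, 2026-08-27. Source: S. A. Zlobin, *Properties of coefficients of certain linear forms in generalized polylogarithms*,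
Fundam. Prikl. Mat. **11** (2005) no. 6, 41–58 = arXiv:math/0511245 [Zlobin2005Coefficients], §1 eq. (3):
`V_{2l+1,n} = ∫_{[0,1]^{2l+1}} ∏ x_iⁿ(1−x_i)ⁿ dx / (∏_{j=1}^{l} (1 − x₁⋯x_{2j})^{n+1} · (1 − x₁x₂⋯x_{2l+1})^{n+1})` (quoted there
from [Zlobin2002Integrals]); it is the case `n` odd of S. Fischler, C. R. Math. **335** (2002) Corollaire 2.2 [Fischler2002Polyzetas],
PROVED in the tree as `Fischler2002.corollaire22_vasilyev_holds`.

HONEST FRAMING (cells pub-zeta5 / zeta5-irr): systematic search; no irrationality claim unless certified. An identity between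
multiple integrals of non-negative functions; not an irrationality statement; nothing about `ζ(5)`.

## The proof (a vocabulary bridge, no new analysis)
Both sides are Bochner integrals over the closed cube of non-negative measurable functions, hence the `toReal` of the
corresponding lower Lebesgue integrals (`integral_eq_lintegral_of_nonneg_ae`; no integrability is needed). Zudilin's nested kernel
`Q_m(x₁,…,x_m) = 1 − x₁Q_{m−1}(x₂,…)` (`Zudilin2002.nestedQ`) is Vasilyev's `δ_m` of Fischler's file at the reversed point
(`nestedQ_ofFn_eq_deltaV_rev`), the real powers `x^{(n+1)−1}` are the natural powers `xⁿ`, Zlobin's `headProd` is Fischler's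
`headProduct`, and Zlobin's block ends `r_j = 2j` (`j ≤ l`), `r_{l+1} = 2l+1` enumerate exactly the even `k ∈ {2,…,2l+1}` together
with `k = 2l+1`; so the left side is `Fischler2002.vasilyevIntegral (2l+1) n` (after the cube reversal `KL.lintegral_cube_rev`) and the
right side is `Fischler2002.vasilyevSorokinForm (2l+1) n`, which agree by `corollaire22_vasilyev_holds`. Theorems only; no definition;
no new named fact (net debt −1).
-/

noncomputable section

namespace Literature.NumberTheory.Irrationality.Zlobin2005

open MeasureTheory Set Finset
open scoped ENNReal
open Fischler2002 (coord deltaV headProduct unitCube)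
open Fischler2002.JnChi Fischler2002.JnPsi Fischler2002.KL

namespace VasilyevNestedProduct

/-! ### Zudilin's nested kernel is Vasilyev's `δ` at the reversed point -/

/-- `δ_k(x ∘ rev) = Q(x_{m−k+1},…,x_m)` (the nested kernel of the last `k` variables), `k ≤ m`.
[cite: Zlobin2005Coefficients, §1 (definition of V_{m,n})] -/
theorem deltaV_rev_eq_nestedQ_drop {m : ℕ} (x : Fin m → ℝ) :
    ∀ k : ℕ, k ≤ m → deltaV (fun i : Fin m => x (Fin.rev i)) k = Zudilin2002.nestedQ ((List.ofFn x).drop (m - k))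
  | 0, _ => by
      rw [deltaV, Nat.sub_zero, List.drop_of_length_le (by simp)]
      rfl
  | k + 1, hk => by
      rw [deltaV, deltaV_rev_eq_nestedQ_drop x k (by omega)]
      have hlen : m - (k + 1) < (List.ofFn x).length := by simp; omega
      rw [List.drop_eq_getElem_cons hlen, List.getElem_ofFn, Zudilin2002.nestedQ, show m - (k + 1) + 1 = m - k by omega]
      congr 2
      unfold Fischler2002.coord
      rw [dif_pos ⟨by omega, hk⟩]
      show x (Fin.rev ⟨k + 1 - 1, _⟩) = x ⟨m - (k + 1), _⟩
      exact congrArg x (Fin.ext (by simp only [Fin.val_rev]; omega))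

/-- `Q_m(x₁,…,x_m) = δ_m(x_m,…,x₁)`. [cite: Zlobin2005Coefficients, §1 (definition of V_{m,n})] -/
theorem nestedQ_ofFn_eq_deltaV_rev {m : ℕ} (x : Fin m → ℝ) :
    Zudilin2002.nestedQ (List.ofFn x) = deltaV (fun i : Fin m => x (Fin.rev i)) m := by
  rw [deltaV_rev_eq_nestedQ_drop x m le_rfl, Nat.sub_self, List.drop_zero]

/-! ### Zlobin's `headProd` is Fischler's `headProduct` -/

/-- `x₁⋯x_k` in both vocabularies (`k ≤ m`). [cite: Zlobin2005Coefficients, §1 eq. (1)] -/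
theorem headProd_eq_headProduct {m : ℕ} (x : Fin m → ℝ) : ∀ k : ℕ, k ≤ m → headProd x k = headProduct x k
  | 0, _ => by
      rw [headProduct_zero]
      unfold headProd
      rw [Finset.prod_eq_one fun i hi => absurd (Finset.mem_filter.1 hi).2 (by omega)]
  | k + 1, hk => by
      rw [headProduct_succ, ← headProd_eq_headProduct x k (by omega)]
      unfold headProd
      have hs : Finset.univ.filter (fun i : Fin m => (i : ℕ) < k + 1) =
          insert (⟨k, by omega⟩ : Fin m) (Finset.univ.filter (fun i : Fin m => (i : ℕ) < k)) := by
        ext i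
        simp only [Finset.mem_filter, Finset.mem_univ, true_and, Finset.mem_insert, Fin.ext_iff]
        omega
      rw [hs, Finset.prod_insert (by simp), mul_comm]
      congr 1
      unfold Fischler2002.coord
      rw [dif_pos ⟨by omega, hk⟩]
      exact congrArg x (Fin.ext (by simp))

/-- A product over `Fin m` is a product over the 1-based coordinates. [cite: Zlobin2005Coefficients, §1 eq. (1)] -/
theorem prod_univ_eq_prod_Icc_coord {m : ℕ} (x : Fin m → ℝ) (f : ℝ → ℝ) :
    ∏ i : Fin m, f (x i) = ∏ k ∈ Finset.Icc 1 m, f (coord x k) := by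
  have h1 : ∏ i : Fin m, f (x i) = ∏ i : Fin m, (fun j : ℕ => f (coord x (j + 1))) (i : ℕ) := by
    refine Finset.prod_congr rfl fun i _ => ?_
    have hi := i.2
    simp only
    unfold Fischler2002.coord
    rw [dif_pos ⟨by omega, by omega⟩]
    exact congrArg f (congrArg x (Fin.ext (by simp)))
  have e : Finset.Ico 1 (m + 1) = Finset.Icc 1 m := by
    ext j
    simp only [Finset.mem_Ico, Finset.mem_Icc]
    omega
  rw [h1, Fin.prod_univ_eq_prod_range (fun j => f (coord x (j + 1))) m, Finset.range_eq_Ico,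
    Finset.prod_Ico_add' (fun j => f (coord x j)) 0 m 1, zero_add, e]

/-! ### The two integrands -/

/-- Zudilin's integrand `J_m(n+1; n+1,…,n+1 | 2n+2,…,2n+2)` is Vasilyev's integrand (natural powers) at the reversed point.
[cite: Zlobin2005Coefficients, §1 (definition of V_{m,n})] -/
theorem sorokinIntegrand_eq {m : ℕ} (n : ℕ) (x : Fin m → ℝ) :
    Zudilin2002.sorokinIntegrand m ((n : ℝ) + 1) (fun _ => (n : ℝ) + 1) (fun _ => 2 * (n : ℝ) + 2) x =
      (∏ k ∈ Finset.Icc 1 m, coord (fun i : Fin m => x (Fin.rev i)) k ^ n *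
          (1 - coord (fun i : Fin m => x (Fin.rev i)) k) ^ n) / deltaV (fun i : Fin m => x (Fin.rev i)) m ^ (n + 1) := by
  unfold Zudilin2002.sorokinIntegrand
  rw [nestedQ_ofFn_eq_deltaV_rev, show ((n : ℝ) + 1) = ((n + 1 : ℕ) : ℝ) by push_cast; ring, Real.rpow_natCast]
  congr 1
  have h1 : ∏ j : Fin m, x j ^ (((n + 1 : ℕ) : ℝ) - 1) * (1 - x j) ^ (2 * (n : ℝ) + 2 - ((n + 1 : ℕ) : ℝ) - 1) =
      ∏ j : Fin m, (fun t : ℝ => t ^ n * (1 - t) ^ n) (x j) := by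
    refine Finset.prod_congr rfl fun j _ => ?_
    simp only
    rw [show (((n + 1 : ℕ) : ℝ) - 1) = ((n : ℕ) : ℝ) by push_cast; ring,
      show (2 * (n : ℝ) + 2 - ((n + 1 : ℕ) : ℝ) - 1) = ((n : ℕ) : ℝ) by push_cast; ring, Real.rpow_natCast, Real.rpow_natCast]
  rw [h1, prod_univ_eq_prod_Icc_coord x (fun t : ℝ => t ^ n * (1 - t) ^ n)]
  symm
  exact prod_Icc_reflect fun k _ => by rw [coord_rev]

/-- Zlobin's block ends `r_j = 2j` (`j ≤ l`), `r_{l+1} = 2l+1` enumerate the even `k ∈ {2,…,2l+1}` together with `k = 2l+1`.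
[cite: Zlobin2005Coefficients, §1 eq. (3)] -/
theorem prod_blockEnds {l : ℕ} (hl : 1 ≤ l) (f : ℕ → ℝ) :
    ∏ j ∈ Finset.Icc 1 (l + 1), f (if j ≤ l then 2 * j else 2 * l + 1) =
      ∏ k ∈ (Finset.Icc 2 (2 * l + 1)).filter (fun k => Even k ∨ k = 2 * l + 1), f k := by
  rw [Finset.prod_Icc_succ_top (show 1 ≤ l + 1 by omega), if_neg (show ¬ (l + 1 ≤ l) by omega)]
  have himg : (Finset.Icc 2 (2 * l + 1)).filter (fun k => Even k ∨ k = 2 * l + 1) =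
      insert (2 * l + 1) ((Finset.Icc 1 l).image (fun j => 2 * j)) := by
    ext k
    simp only [Finset.mem_filter, Finset.mem_Icc, Finset.mem_insert, Finset.mem_image]
    constructor
    · rintro ⟨⟨h2, hk⟩, (⟨r, hr⟩ | h)⟩
      · refine Or.inr ⟨r, ⟨?_, ?_⟩, ?_⟩ <;> omega
      · exact Or.inl h
    · rintro (h | ⟨j, ⟨hj1, hjl⟩, rfl⟩)
      · refine ⟨⟨?_, ?_⟩, Or.inr h⟩ <;> omega
      · refine ⟨⟨?_, ?_⟩, Or.inl ⟨j, ?_⟩⟩ <;> omega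
  have hnot : 2 * l + 1 ∉ (Finset.Icc 1 l).image (fun j => 2 * j) := by
    rw [Finset.mem_image]
    rintro ⟨j, _, h⟩
    omega
  rw [himg, Finset.prod_insert hnot, Finset.prod_image (fun i _ j _ h => by simpa using h), mul_comm]
  congr 1
  exact Finset.prod_congr rfl fun j hj => by rw [if_pos (Finset.mem_Icc.1 hj).2]

/-- Zlobin's integrand (1) for the parameters (3) at `z = 1` is Fischler's Sorokin-type integrand.
[cite: Zlobin2005Coefficients, §1 eq. (3)] [cite: Fischler2002Polyzetas, §2 Corollaire 2.2] -/
theorem integrand_vasilyevParams_eq {l : ℕ} (hl : 1 ≤ l) (n : ℕ) (x : Fin (2 * l + 1) → ℝ) :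
    (∏ i : Fin (2 * l + 1), x i ^ (n + 1 - 1) * (1 - x i) ^ (2 * n + 2 - (n + 1) - 1)) /
        ∏ j ∈ Finset.Icc 1 (l + 1), (1 - 1 * headProd x (if j ≤ l then 2 * j else 2 * l + 1)) ^ (n + 1) =
      (∏ k ∈ Finset.Icc 1 (2 * l + 1), coord x k ^ n * (1 - coord x k) ^ n) /
        ∏ k ∈ (Finset.Icc 2 (2 * l + 1)).filter (fun k => Even k ∨ k = 2 * l + 1), (1 - headProduct x k) ^ (n + 1) := by
  rw [show n + 1 - 1 = n from rfl, show 2 * n + 2 - (n + 1) - 1 = n by omega,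
    prod_univ_eq_prod_Icc_coord x (fun t : ℝ => t ^ n * (1 - t) ^ n)]
  congr 1
  rw [prod_blockEnds hl (fun k => (1 - 1 * headProd x k) ^ (n + 1))]
  refine Finset.prod_congr rfl fun k hk => ?_
  rw [one_mul, headProd_eq_headProduct x k (Finset.mem_Icc.1 (Finset.mem_filter.1 hk).1).2]

/-! ### Measurability and non-negativity on the closed cube -/

/-- On the closed cube `0 ≤ δ_k ≤ 1`. [cite: Zlobin2005Coefficients, §1 (definition of V_{m,n})] -/
theorem deltaV_mem_Icc {m : ℕ} {y : Fin m → ℝ} (hy : ∀ i, 0 ≤ y i ∧ y i ≤ 1) :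
    ∀ k : ℕ, 0 ≤ deltaV y k ∧ deltaV y k ≤ 1
  | 0 => by simp [deltaV]
  | k + 1 => by
      obtain ⟨h0, h1⟩ := deltaV_mem_Icc hy k
      have hc : 0 ≤ coord y (k + 1) ∧ coord y (k + 1) ≤ 1 := by
        unfold Fischler2002.coord
        split_ifs
        · exact hy _
        · exact ⟨le_rfl, zero_le_one⟩
      rw [deltaV]
      constructor <;> nlinarith [mul_nonneg hc.1 h0, mul_le_mul hc.2 h1 h0 zero_le_one]

/-- Vasilyev's integrand (natural powers) is non-negative on the closed cube. [cite: Zlobin2005Coefficients, §1 (definition of V_{m,n})] -/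
theorem vasilyevIntegrand_nonneg {m : ℕ} (n : ℕ) {y : Fin m → ℝ} (hy : ∀ i, 0 ≤ y i ∧ y i ≤ 1) :
    0 ≤ (∏ k ∈ Finset.Icc 1 m, coord y k ^ n * (1 - coord y k) ^ n) / deltaV y m ^ (n + 1) := by
  refine div_nonneg (Finset.prod_nonneg fun k _ => ?_) (pow_nonneg (deltaV_mem_Icc hy m).1 _)
  have hc : 0 ≤ coord y k ∧ coord y k ≤ 1 := by
    unfold Fischler2002.coord
    split_ifs
    · exact hy _
    · exact ⟨le_rfl, zero_le_one⟩
  exact mul_nonneg (pow_nonneg hc.1 _) (pow_nonneg (by linarith [hc.2]) _)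

/-- Vasilyev's integrand is measurable. [cite: Zlobin2005Coefficients, §1 (definition of V_{m,n})] -/
theorem measurable_vasilyevIntegrand (m n : ℕ) :
    Measurable fun y : Fin m → ℝ => (∏ k ∈ Finset.Icc 1 m, coord y k ^ n * (1 - coord y k) ^ n) / deltaV y m ^ (n + 1) :=
  (Finset.measurable_prod _ fun k _ =>
    ((measurable_coord k).pow_const _).mul ((measurable_const.sub (measurable_coord k)).pow_const _)).div
    ((measurable_deltaV m).pow_const _)

/-- The Sorokin-type integrand is non-negative on the closed cube. [cite: Zlobin2005Coefficients, §1 eq. (3)] -/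
theorem sorokinFormIntegrand_nonneg {m : ℕ} (n : ℕ) (s : Finset ℕ) {X : Fin m → ℝ} (hX : ∀ i, 0 ≤ X i ∧ X i ≤ 1) :
    0 ≤ (∏ k ∈ Finset.Icc 1 m, coord X k ^ n * (1 - coord X k) ^ n) / ∏ k ∈ s, (1 - headProduct X k) ^ (n + 1) := by
  have hc : ∀ k, 0 ≤ coord X k ∧ coord X k ≤ 1 := fun k => by
    unfold Fischler2002.coord
    split_ifs
    · exact hX _
    · exact ⟨le_rfl, zero_le_one⟩
  refine div_nonneg (Finset.prod_nonneg fun k _ => mul_nonneg (pow_nonneg (hc k).1 _) (pow_nonneg (by linarith [(hc k).2]) _))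
    (Finset.prod_nonneg fun k _ => pow_nonneg ?_ _)
  have : headProduct X k ≤ 1 := by
    unfold Fischler2002.headProduct
    exact Finset.prod_le_one (fun i _ => (hc i).1) (fun i _ => (hc i).2)
  linarith

/-- The Sorokin-type integrand is measurable. [cite: Zlobin2005Coefficients, §1 eq. (3)] -/
theorem measurable_sorokinFormIntegrand (m n : ℕ) (s : Finset ℕ) :
    Measurable fun X : Fin m → ℝ =>
      (∏ k ∈ Finset.Icc 1 m, coord X k ^ n * (1 - coord X k) ^ n) / ∏ k ∈ s, (1 - headProduct X k) ^ (n + 1) :=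
  (Finset.measurable_prod _ fun k _ =>
    ((measurable_coord k).pow_const _).mul ((measurable_const.sub (measurable_coord k)).pow_const _)).div
    (Finset.measurable_prod _ fun k _ => (measurable_const.sub (measurable_headProduct k)).pow_const _)

/-- The closed cube is measurable. [folklore] -/
private theorem measurableSet_unitCube (m : ℕ) : MeasurableSet (Set.pi Set.univ fun _ : Fin m => Set.Icc (0 : ℝ) 1) :=
  MeasurableSet.univ_pi fun _ => measurableSet_Icc

end VasilyevNestedProduct

open VasilyevNestedProduct in
/-- **Zlobin's (3) holds** (the named fact `vasilyevIntegral_eq_nestedProduct` of `SorokinIntegralCoefficients.lean` is a theorem):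
for `l ≥ 1` and every `n`, Vasilyev's integral `V_{2l+1,n}` (the tree's `Zudilin2002.sorokinIntegral` with parameters
`n+1; n+1,…,n+1 | 2n+2,…,2n+2`) equals the nested-product integral `S(1)` of the parameters (3) — `l+1` denominator factors
`(1 − x₁⋯x_{2j})^{n+1}` (`j ≤ l`) and `(1 − x₁⋯x_{2l+1})^{n+1}`. A vocabulary bridge to the tree's PROVED
`Fischler2002.corollaire22_vasilyev_holds` (Fischler 2002 Cor. 2.2, the change of variables of Théorème 2.1): both Bochner integrals
are `toReal` of lower integrals of non-negative functions (no integrability needed), `Q_m = δ_m ∘ rev`, real powers are natural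
powers, and the block ends are the even indices together with `2l+1`.
[cite: Zlobin2005Coefficients, §1 eq. (3)] [cite: Fischler2002Polyzetas, §2 Corollaire 2.2] -/
theorem vasilyevIntegral_eq_nestedProduct_holds : vasilyevIntegral_eq_nestedProduct := by
  intro l n hl
  have hm2 : 2 ≤ 2 * l + 1 := by omega
  -- the left side as a lower integral of Vasilyev's integrand
  have hL : vasilyevIntegral (2 * l + 1) n = (Fischler2002.vasilyevIntegral (2 * l + 1) n).toReal := by
    unfold vasilyevIntegral Zudilin2002.sorokinIntegral Fischler2002.vasilyevIntegral
    rw [show (Set.pi Set.univ fun _ : Fin (2 * l + 1) => Set.Icc (0 : ℝ) 1) = unitCube (2 * l + 1) from rfl,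
      show Zudilin2002.sorokinIntegrand (2 * l + 1) ((n : ℝ) + 1) (fun _ => (n : ℝ) + 1) (fun _ => 2 * (n : ℝ) + 2) =
        fun x : Fin (2 * l + 1) → ℝ => (∏ k ∈ Finset.Icc 1 (2 * l + 1), coord (fun i => x (Fin.rev i)) k ^ n *
          (1 - coord (fun i => x (Fin.rev i)) k) ^ n) / deltaV (fun i => x (Fin.rev i)) (2 * l + 1) ^ (n + 1)
        from funext (sorokinIntegrand_eq n)]
    have hrev : Measurable fun x : Fin (2 * l + 1) → ℝ => fun i => x (Fin.rev i) :=
      measurable_pi_lambda _ fun i => measurable_pi_apply _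
    rw [integral_eq_lintegral_of_nonneg_ae]
    · congr 1
      rw [← setLIntegral_congr (openCube_ae_eq_unitCube (2 * l + 1)),
        ← setLIntegral_congr (openCube_ae_eq_unitCube (2 * l + 1)),
        ← lintegral_cube_rev (2 * l + 1) (fun y => ENNReal.ofReal
          ((∏ k ∈ Finset.Icc 1 (2 * l + 1), coord y k ^ n * (1 - coord y k) ^ n) / deltaV y (2 * l + 1) ^ (n + 1)))]
    · refine (ae_restrict_iff' (measurableSet_unitCube _)).2 (Filter.Eventually.of_forall fun x hx => ?_)
      have hx' : ∀ i, 0 ≤ x (Fin.rev i) ∧ x (Fin.rev i) ≤ 1 := fun i => (Set.mem_univ_pi.1 hx) (Fin.rev i)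
      exact vasilyevIntegrand_nonneg n hx'
    · exact ((measurable_vasilyevIntegrand (2 * l + 1) n).comp hrev).aestronglyMeasurable
  -- the right side as a lower integral of the Sorokin-type integrand
  have hR : (vasilyevParams l n).S 1 = (Fischler2002.vasilyevSorokinForm (2 * l + 1) n).toReal := by
    have hS : (vasilyevParams l n).S 1 = ∫ x in Set.pi Set.univ (fun _ : Fin (2 * l + 1) => Set.Icc (0 : ℝ) 1),
        (∏ i : Fin (2 * l + 1), x i ^ (n + 1 - 1) * (1 - x i) ^ (2 * n + 2 - (n + 1) - 1)) /
          ∏ j ∈ Finset.Icc 1 (l + 1), (1 - 1 * headProd x (if j ≤ l then 2 * j else 2 * l + 1)) ^ (n + 1) := rfl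
    rw [hS, funext (integrand_vasilyevParams_eq hl n)]
    unfold Fischler2002.vasilyevSorokinForm Fischler2002.unitCube
    rw [integral_eq_lintegral_of_nonneg_ae]
    · refine (ae_restrict_iff' (measurableSet_unitCube _)).2 (Filter.Eventually.of_forall fun X hX => ?_)
      exact sorokinFormIntegrand_nonneg n _ (fun i => (Set.mem_univ_pi.1 hX) i)
    · exact (measurable_sorokinFormIntegrand (2 * l + 1) n _).aestronglyMeasurable
  rw [hL, hR, Fischler2002.corollaire22_vasilyev_holds (2 * l + 1) n hm2]

end Literature.NumberTheory.Irrationality.Zlobin2005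

end
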